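import Mathlib
import Summits.Schanuel.Schanuel.Theorems.RootDecomp1EModuleGrids

-- `Summit.Schanuel.Schanuel.…` is the mandated layout of this single-problem summit (CONVENTIONS §1).
set_option linter.dupNamespace false

/-!
# RootDecomp1E — lens 2, gen 8 «ModuleGrids» (cells, part 1/2 = §3): the certified cell `z♯` (§4 `z★` in `RootDecomp1EModuleGridsCells`)

Two certified members of the hypothesis class of `RootDecomp1E.PlainDefectOne` (stmt-Schanuel-31410) at its
first open length `n = 3` on which its conclusion `S⁻` is PROVED (mod the tree theorem
`smallTrdeg_thm_2_9_two_two` = Brownawell–Waldschmidt), by the twisted-log-pair cell of part 1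
(`Theorems.RootDecomp1EModuleGrids.two_le_trdeg_of_twistedLogPair`):
* §3 `z♯ = (log 2, π·log 2, iπ²)` — ℚ-free, NO irrational multiplier (plain), sub-minimal; two of
  `log 2, π, 2^π, e^{iπ²}` are algebraically independent; the B–W corner `iπ ∉ span_ℚ z♯`;
* §4 `z★ = (log 2, log 3, iπ·log 3/log 2)` — same certificates (`log 3/log 2 ∉ ℚ`); two of
  `log 2, log 3, π, e^{iπ log 3/log 2}` are algebraically independent, over the OPEN pair `(log 2, log 3)`.
Sorry-free; axioms `propext`, `Classical.choice`, `Quot.sound`.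
[cite: BakerTNT1975, Ch. 12 Theorem 12.2]
-/

noncomputable section

namespace Summit.Schanuel.Schanuel.Theorems.RootDecomp1EModuleGrids

open Complex IntermediateField
open Summit.Schanuel.Schanuel.Theorems.RootDecomp1EAnchor (isAlgebraic_of_mem_adjoin
  trdeg_adjoin_le_of_isAlgebraic mem_adjoin_of_mem_span exp_isAlgebraic_of_mem_span trdeg_le_of_mem_span)
open Literature.Barriers.Schanuel (gridField₂ smallTrdeg_thm_2_9_two_two trdeg_mono)
open Summit.Schanuel.Schanuel.Theorems.RootDecomp1EEStableRung (defectOne_of_le_two)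

/-! ## §3 The certified instance `z♯ = (log 2, π log 2, iπ²)` -/

/-- `log 2` as a complex number. -/
def L2 : ℂ := ((Real.log 2 : ℝ) : ℂ)

/-- `π` as a complex number. -/
def P : ℂ := ((Real.pi : ℝ) : ℂ)

/-- `log 2 ≠ 0`. -/
theorem log_two_ne_zero : Real.log 2 ≠ 0 := (Real.log_pos (by norm_num)).ne'

/-- `log 2 ≠ 0` in `ℂ`. -/
theorem L2_ne_zero : L2 ≠ 0 := by
  rw [L2, Ne, Complex.ofReal_eq_zero]
  exact log_two_ne_zero

/-- `π ≠ 0` in `ℂ`. -/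
theorem P_ne_zero : P ≠ 0 := by
  rw [P, Ne, Complex.ofReal_eq_zero]
  exact Real.pi_ne_zero

/-- `e^{log 2} = 2`. -/
theorem exp_L2 : cexp L2 = 2 := by
  rw [L2, ← Complex.ofReal_exp, Real.exp_log (by norm_num : (0 : ℝ) < 2)]
  norm_num

/-- `e^{iπ} = -1`. -/
theorem exp_P_mul_I : cexp (P * I) = -1 := by
  rw [P]
  exact Complex.exp_pi_mul_I

/-- `e^{log 2}` is algebraic. -/
theorem isAlgebraic_exp_L2 : IsAlgebraic ℚ (cexp L2) := by
  rw [exp_L2]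
  simpa using isAlgebraic_nat (R := ℚ) (A := ℂ) 2

/-- `e^{iπ}` is algebraic. -/
theorem isAlgebraic_exp_P_mul_I : IsAlgebraic ℚ (cexp (P * I)) := by
  rw [exp_P_mul_I]
  exact isAlgebraic_one.neg

/-- `(log 2, iπ)` is ℚ-free (real vs imaginary). -/
theorem linearIndependent_L2_PI : LinearIndependent ℚ ![L2, P * I] := by
  rw [LinearIndependent.pair_iff]
  intro s t hst
  rw [Rat.smul_def, Rat.smul_def] at hst
  have hre := congrArg Complex.re hst
  have him := congrArg Complex.im hst
  simp only [L2, P, Complex.add_re, Complex.add_im, Complex.mul_re, Complex.mul_im, Complex.ofReal_re,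
    Complex.ofReal_im, Complex.I_re, Complex.I_im, Complex.ratCast_re, Complex.ratCast_im,
    Complex.zero_re, Complex.zero_im, mul_zero, zero_mul, sub_zero, add_zero, zero_add, mul_one,
    sub_self] at hre him
  -- hre : s * log 2 = 0 ; him : t * π = 0
  have hs : (s : ℝ) = 0 := by
    rcases mul_eq_zero.mp (show (s : ℝ) * Real.log 2 = 0 by linear_combination hre) with h | h
    · exact h
    · exact absurd h log_two_ne_zero
  have ht : (t : ℝ) = 0 := by
    rcases mul_eq_zero.mp (show (t : ℝ) * Real.pi = 0 by linear_combination him) with h | h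
    · exact h
    · exact absurd h Real.pi_ne_zero
  exact ⟨by exact_mod_cast hs, by exact_mod_cast ht⟩

/-- `(1, π)` is ℚ-free (`π ∉ ℚ`). -/
theorem linearIndependent_one_P : LinearIndependent ℚ ![(1 : ℂ), P] := by
  rw [LinearIndependent.pair_iff]
  intro s t hst
  rw [Rat.smul_def, Rat.smul_def] at hst
  have hre := congrArg Complex.re hst
  simp only [P, Complex.add_re, Complex.mul_re, Complex.ofReal_re, Complex.ofReal_im,
    Complex.ratCast_re, Complex.ratCast_im, Complex.zero_re,
    mul_zero, sub_zero, mul_one] at hre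
  have hre' : (t : ℝ) * Real.pi = ((-s : ℚ) : ℝ) := by push_cast; linear_combination hre
  obtain ⟨ht, hs⟩ := rat_mul_pi_eq_rat hre'
  exact ⟨by simpa using hs, ht⟩

/-- **`z♯ = (log 2, π·log 2, iπ²)`.** -/
def zSharp : Fin 3 → ℂ := ![L2, P * L2, P * (P * I)]

/-- `z♯` is ℚ-free. -/
theorem zSharp_linearIndependent : LinearIndependent ℚ zSharp := by
  rw [Fintype.linearIndependent_iff]
  intro g hg
  simp only [Fin.sum_univ_three, zSharp, Matrix.cons_val_zero, Matrix.cons_val_one,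
    Matrix.cons_val_two, Matrix.tail_cons, Matrix.head_cons, Rat.smul_def] at hg
  have hre := congrArg Complex.re hg
  have him := congrArg Complex.im hg
  simp only [L2, P, Complex.add_re, Complex.add_im, Complex.mul_re, Complex.mul_im, Complex.ofReal_re,
    Complex.ofReal_im, Complex.I_re, Complex.I_im, Complex.ratCast_re, Complex.ratCast_im,
    Complex.zero_re, Complex.zero_im, mul_zero, zero_mul, sub_zero, add_zero, zero_add, mul_one,
    sub_self] at hre him
  -- him : g 2 * π² = 0
  have h2 : g 2 = 0 := by
    have h : (g 2 : ℝ) * (Real.pi * Real.pi) = 0 := by linear_combination him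
    rcases mul_eq_zero.mp h with h | h
    · exact_mod_cast h
    · exact absurd h (mul_ne_zero Real.pi_ne_zero Real.pi_ne_zero)
  -- hre : (g 0 + g 1 π) log 2 = 0
  have hre' : ((g 0 : ℝ) + (g 1 : ℝ) * Real.pi) * Real.log 2 = 0 := by linear_combination hre
  have hre'' : (g 1 : ℝ) * Real.pi = ((-g 0 : ℚ) : ℝ) := by
    have := (mul_eq_zero.mp hre').resolve_right log_two_ne_zero
    push_cast; linear_combination this
  obtain ⟨h1, h0⟩ := rat_mul_pi_eq_rat hre''
  have h0' : g 0 = 0 := by simpa using h0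
  intro i
  fin_cases i
  · exact h0'
  · exact h1
  · exact h2

/-- **`z♯` has NO irrational multiplier** (in particular it is PLAIN in the sense of stmt-31410): a complex `β`
with `β·z♯ᵢ ∈ span_ℚ z♯` for all `i` is rational.  Only `π ∉ ℚ` is used. -/
theorem zSharp_multiplier_rational (β : ℂ) (hβ : ∀ i, β * zSharp i ∈ Submodule.span ℚ (Set.range zSharp)) :
    β ∈ Set.range (algebraMap ℚ ℂ) := by
  obtain ⟨a, ha⟩ := (Submodule.mem_span_range_iff_exists_fun ℚ).mp (hβ 0)
  obtain ⟨b, hb⟩ := (Submodule.mem_span_range_iff_exists_fun ℚ).mp (hβ 1)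
  obtain ⟨c, hc⟩ := (Submodule.mem_span_range_iff_exists_fun ℚ).mp (hβ 2)
  simp only [Fin.sum_univ_three, zSharp, Matrix.cons_val_zero, Matrix.cons_val_one,
    Matrix.cons_val_two, Matrix.tail_cons, Matrix.head_cons, Rat.smul_def] at ha hb hc
  have ha_re := congrArg Complex.re ha
  have ha_im := congrArg Complex.im ha
  have hb_im := congrArg Complex.im hb
  have hc_im := congrArg Complex.im hc
  simp only [L2, P, Complex.add_re, Complex.add_im, Complex.mul_re, Complex.mul_im, Complex.ofReal_re,
    Complex.ofReal_im, Complex.I_re, Complex.I_im, Complex.ratCast_re, Complex.ratCast_im,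
    mul_zero, zero_mul, sub_zero, add_zero, zero_add, mul_one,
    sub_self] at ha_re ha_im hb_im hc_im
  have hπ : Real.pi ≠ 0 := Real.pi_ne_zero
  -- hc_im : c 2 π² = βr π²  ⇒  βr = c 2
  have hβr : β.re = (c 2 : ℝ) := by
    have h : (β.re - (c 2 : ℝ)) * (Real.pi * Real.pi) = 0 := by linear_combination -hc_im
    have := (mul_eq_zero.mp h).resolve_right (mul_ne_zero hπ hπ)
    linear_combination this
  -- ha_re : a 0 log 2 + a 1 π log 2 = βr log 2  ⇒  βr = a 0 + a 1 π  ⇒  a 1 π = c 2 - a 0  ⇒  a 1 = 0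
  have hβr' : β.re = (a 0 : ℝ) + (a 1 : ℝ) * Real.pi := by
    have h : (β.re - (a 0 : ℝ) - (a 1 : ℝ) * Real.pi) * Real.log 2 = 0 := by linear_combination -ha_re
    have := (mul_eq_zero.mp h).resolve_right log_two_ne_zero
    linear_combination this
  have hπ1 : (a 1 : ℝ) * Real.pi = ((c 2 - a 0 : ℚ) : ℝ) := by
    push_cast; linear_combination hβr - hβr'
  obtain ⟨_, _⟩ := rat_mul_pi_eq_rat hπ1
  -- ha_im : a 2 π² = βi log 2 ; hb_im : b 2 π² = βi π log 2  ⇒  βi log 2 = b 2 π  ⇒  a 2 π = b 2  ⇒  b 2 = 0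
  have hβi1 : β.im * Real.log 2 = (a 2 : ℝ) * (Real.pi * Real.pi) := by linear_combination -ha_im
  have hβi2 : β.im * Real.log 2 = (b 2 : ℝ) * Real.pi := by
    have h : (β.im * Real.log 2 - (b 2 : ℝ) * Real.pi) * Real.pi = 0 := by linear_combination -hb_im
    have := (mul_eq_zero.mp h).resolve_right hπ
    linear_combination this
  have hπ2 : (a 2 : ℝ) * Real.pi = ((b 2 : ℚ) : ℝ) := by
    have h : ((a 2 : ℝ) * Real.pi - (b 2 : ℝ)) * Real.pi = 0 := by linear_combination hβi2 - hβi1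
    have := (mul_eq_zero.mp h).resolve_right hπ
    linear_combination this
  obtain ⟨_, hb2⟩ := rat_mul_pi_eq_rat hπ2
  have hβi : β.im = 0 := by
    have h : β.im * Real.log 2 = 0 := by rw [hβi2, hb2]; push_cast; ring
    exact (mul_eq_zero.mp h).resolve_right log_two_ne_zero
  refine ⟨c 2, ?_⟩
  apply Complex.ext
  · simp [hβr]
  · simp [hβi]

/-- `z♯` is SUB-MINIMAL (automatic at length 3: every ℚ-free tuple of length `≤ 2` satisfies `S⁻`). -/
theorem zSharp_subMinimal : ∀ (m : ℕ) (w : Fin m → ℂ), m < 3 → LinearIndependent ℚ w →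
    (∀ j, w j ∈ Submodule.span ℚ (Set.range zSharp)) →
    (m : Cardinal) ≤ Algebra.trdeg ℚ ↥(adjoin ℚ (Set.range w ∪ Set.range (cexp ∘ w))) + 1 :=
  fun m w hm hw _ => defectOne_of_le_two m (by omega) w hw

/-- `π ∈ K_{z♯}` (`π = (π log 2)/log 2`). -/
theorem P_mem_adjoin_zSharp : P ∈ adjoin ℚ (Set.range zSharp ∪ Set.range (cexp ∘ zSharp)) := by
  have h0 : zSharp 0 ∈ adjoin ℚ (Set.range zSharp ∪ Set.range (cexp ∘ zSharp)) :=
    subset_adjoin ℚ _ (Or.inl ⟨0, rfl⟩)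
  have h1 : zSharp 1 ∈ adjoin ℚ (Set.range zSharp ∪ Set.range (cexp ∘ zSharp)) :=
    subset_adjoin ℚ _ (Or.inl ⟨1, rfl⟩)
  have : P = zSharp 1 * (zSharp 0)⁻¹ := by
    simp only [zSharp, Matrix.cons_val_zero, Matrix.cons_val_one]
    field_simp [L2_ne_zero]
  rw [this]
  exact mul_mem h1 (inv_mem h0)

/-- `π · log 2 ∈ span_ℚ z♯`. -/
theorem zSharp_one_mem_span : P * L2 ∈ Submodule.span ℚ (Set.range zSharp) :=
  Submodule.subset_span ⟨1, by simp [zSharp]⟩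

/-- `π · iπ ∈ span_ℚ z♯`. -/
theorem zSharp_two_mem_span : P * (P * I) ∈ Submodule.span ℚ (Set.range zSharp) :=
  Submodule.subset_span ⟨2, by simp [zSharp]⟩

/-- **DECIDED (mod B–W): `2 ≤ trdeg_ℚ ℚ(z♯, e^{z♯})`, i.e. two of `log 2, π, 2^π, e^{iπ²}` are
algebraically independent.**  Twisted log pair `l₁ = log 2`, `l₂ = iπ`, `μ = π`. -/
theorem two_le_trdeg_zSharp (hBW : smallTrdeg_thm_2_9_two_two) :
    (2 : Cardinal) ≤ Algebra.trdeg ℚ ↥(adjoin ℚ (Set.range zSharp ∪ Set.range (cexp ∘ zSharp))) :=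
  two_le_trdeg_of_twistedLogPair hBW zSharp L2 (P * I) P linearIndependent_L2_PI linearIndependent_one_P
    isAlgebraic_exp_L2 isAlgebraic_exp_P_mul_I P_mem_adjoin_zSharp zSharp_one_mem_span zSharp_two_mem_span

/-- **`S⁻` HOLDS AT `z♯`** (the conclusion of stmt-31410 / stmt-25020 at `n = 3`, `z = z♯`), mod B–W. -/
theorem defectOne_zSharp (hBW : smallTrdeg_thm_2_9_two_two) :
    ((3 : ℕ) : Cardinal) ≤ Algebra.trdeg ℚ ↥(adjoin ℚ (Set.range zSharp ∪ Set.range (cexp ∘ zSharp))) + 1 :=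
  defectOne_three_of_twistedLogPair hBW zSharp L2 (P * I) P linearIndependent_L2_PI linearIndependent_one_P
    isAlgebraic_exp_L2 isAlgebraic_exp_P_mul_I P_mem_adjoin_zSharp zSharp_one_mem_span zSharp_two_mem_span

/-- **The grid is NOT in the span**: the corner `iπ` of the B–W configuration `{log 2, iπ, π log 2, iπ²}`
does not lie in `span_ℚ z♯` (`π ∉ ℚ`), so `z♯` is outside round 7's grid-in-span cell (e) and outside the
hypothesis of its blindness theorem. -/
theorem PI_not_mem_span_zSharp : P * I ∉ Submodule.span ℚ (Set.range zSharp) := by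
  intro h
  obtain ⟨c, hc⟩ := (Submodule.mem_span_range_iff_exists_fun ℚ).mp h
  simp only [Fin.sum_univ_three, zSharp, Matrix.cons_val_zero, Matrix.cons_val_one,
    Matrix.cons_val_two, Matrix.tail_cons, Matrix.head_cons, Rat.smul_def] at hc
  have him := congrArg Complex.im hc
  simp only [L2, P, Complex.add_im, Complex.mul_re, Complex.mul_im, Complex.ofReal_re,
    Complex.ofReal_im, Complex.I_re, Complex.I_im, Complex.ratCast_re, Complex.ratCast_im,
    mul_zero, zero_mul, sub_zero, add_zero, zero_add, mul_one,
    sub_self] at him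
  -- him : c 2 * (π * π) = π
  have h1 : (c 2 : ℝ) * Real.pi = ((1 : ℚ) : ℝ) := by
    have h : ((c 2 : ℝ) * Real.pi - 1) * Real.pi = 0 := by linear_combination him
    have := (mul_eq_zero.mp h).resolve_right Real.pi_ne_zero
    push_cast; linear_combination this
  obtain ⟨_, h10⟩ := rat_mul_pi_eq_rat h1
  exact one_ne_zero h10

end Summit.Schanuel.Schanuel.Theorems.RootDecomp1EModuleGrids
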